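import Mathlib
import HarnessLib
import Summits.CriticalPhenomena.SAWScalingLimit.Theses.SAWDevelopingMap
import Summits.CriticalPhenomena.SAWScalingLimit.Theorems.SAWDevelopingMapInteriorFlatteningOneMouthDefs
import Summits.CriticalPhenomena.SAWScalingLimit.Theorems.SAWDevelopingMapInteriorFlatteningFactorisation
import Summits.CriticalPhenomena.SAWScalingLimit.Theorems.SAWDevelopingMapInteriorFlatteningOneMouthSimplyConnected
import Summits.CriticalPhenomena.SAWScalingLimit.Theorems.SAWDevelopingMapInteriorFlatteningDeepBoundedDistortion
import Literature.Probability.RandomPlanarGeometry.HexDomainSingleton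
import Literature.Barriers.CriticalPhenomena.ParafermionicHalfCauchyRiemann

/-!
# Line `one-mouth-ball-reduction` — skeleton for crux `InteriorFlattening`
(stmt-CriticalPhenomena-8297, route `SAWDevelopingMap`)

The crux (M): `∀ ε > 0, ∃ R, ∀ Λ` simply connected, `∀ a ∈ ∂Λ`, `∀ v` with the Euclidean `R`-ball
of lattice vertices inside `Λ`, for every labelling `w₀ w₁ w₂` of the neighbours of `v`:
`‖F{v,w₀} + ω F{v,w₁} + ω² F{v,w₂}‖ ≤ ε ‖F{v,w₀} + F{v,w₁} + F{v,w₂}‖`, `F` the DCS observable at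
`(x_c, 5/8)`, `ω = e^{2πi/3}` (Beltrami mode `B` over monopole `M`).

THE LINE (idea card `one-mouth-ball-reduction`, ideator 2, merged by the triage panel with
`access-arc-cone-bound`): cut every walk `a → {v, wᵢ}` at its LAST ENTRANCE into the lattice ball
`S = B(v, r)`.  The piece after the cut is a walk of the ONE-MOUTH SUB-BALL `D = S ∖ (earlier
excursions)` from the entrance mid-edge `q = {u, u'}` (`u ∉ S`, `u' ∈ S`), so — grouping the outer
pieces by the local CONFIGURATION `c = (D, q)` they leave behind — the triple of port values is an
exact finite superposition (stub `stub_factorisation`, S1)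

  `F_Λ,a({v,wᵢ}) = Σ_c amp(c) · F_{D,q}({v,wᵢ})`,   `amp(c) = Σ_{outer pieces ↦ c} e^{-iσW} x_c^ℓ`,

with every `(D, q)` again a crux configuration (simply connected: stub `stub_oneMouthSimplyConnected`,
S2; entrance root on the outer sphere; `v` inside).  Hence `B_Λ = Σ_c amp(c) B_c`, `M_Λ = Σ_c amp(c) M_c`
and `μ_Λ(v)` is a COMPLEX-WEIGHTED AVERAGE of the inner Beltrami quotients `μ_c = B_c/M_c` with
weights `amp(c) M_c`.  Three inputs close the estimate at one scale (no recursion is needed):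

* FAR-FIELD COHERENCE (stub `stub_farFieldCoherence`, S3, the card's lever, uses simple connectivity
  of `Λ` and the clean collar `B(v,2r) ⊆ Λ`): the amplification of the average is bounded,
  `Σ_c ‖amp(c)‖ ‖M_c‖ ≤ A ‖Σ_c amp(c) M_c‖` uniformly — the far field (all sheets, all far paths) is
  summed COHERENTLY inside each `amp(c)`, only the local configuration index is summed incoherently
  (answer to TRIAGE r1-2 (3) / r1-3 (a): a walk-level or positive-mass cone bound is false, the
  configuration-level amplification is the statement; it is a bound on the between-configuration
  spread of the conditional mean winding, which a two-corridor (non simply connected) far field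
  violates by the factor `2+√3` of `Disproof.lean` §(c) / `noFoldBound_false_without_simplyConnected`);
* ONE-MOUTH BALL FLATTENING (stub `stub_oneMouthBallFlattening`, S4, HARDEST — the clean core):
  for configurations whose excursions stay outside `B(v, ηr)` the inner quotient is `≤ e(r) → 0`,
  for every fixed aspect ratio `η ∈ (0,1]` (bounded geometry, source on the outer sphere: the far
  field is gone);
* RE-ENTRY ARM SEPARATION (stub `stub_reentryArmSeparation`, S5, the card's "arm gap", made an
  explicit stub as TRIAGE r1-2 (1) asks): configurations whose excursions penetrate `B(v, ηr)` carry
  a fraction `≤ ϑ(η) → 0` of the coherent weight `Σ‖amp‖‖M_c‖` (3 crossings of `A(ηr, r)` against 1: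
  exponent `x₃ − x₁ = 3/2` minus the monopole loss `25/48`), and those penetrating a FIXED ball
  `B(v, d₀)` carry, even in inner-MASS weight, a vanishing fraction as `r → ∞`
  (`(d₀/r)^{3/2} · r^{25/48} → 0`);
* plus the a-priori bound that makes the middle tier finite: BOUNDED DISTORTION AT SOME DEPTH
  (stub `stub_deepBoundedDistortion`, S6: `∃ d₁ K₁`, the quotient is `≤ K₁` at depth `d₁`; weaker
  than both (K) `NoFoldBound` and (M), and necessary for (M)).

One-scale estimate (proved below, `depthFlat_of`): at depth `2r`,
`‖B_Λ‖ ≤ Σ_c ‖amp‖‖B_c‖ ≤ e·Σ_clean + K₁·Σ_middle + Σ_deep ‖amp‖·mass_c ≤ (e + K₁ϑ + ϑ')·N ≤ A(e + K₁ϑ + ϑ')‖M_Λ‖`,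
so `R(ε) = 2 r(ε)` with `e = ϑ' = ε/(3A)`, `K₁ϑ ≤ ε/(3A)`.
Composition `InteriorFlattening_of : S1 → S2 → S3 → S4 → S5 → S6 → InteriorFlattening` is
kernel-checked (no `sorry` outside the six `stub_*`).

Disproof honoured (cdisprove `Disproof.lean`, read through its evidence notes — the file itself is not
mounted in planner/triager jails): (a) `interiorFlattening_false_without_depth` — the depth
hypothesis is used at S3/S5 (`Deep Λ v (2r)`: clean collar) and S4/S6; (b)
`interiorFlatteningNonUniform_holds` (the `∀Λ ∃R` order is vacuous) — every stub keeps the order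
`∀ε ∃r₀ ∀(Λ, a, v)`; (c) simple connectivity load-bearing — S3 is stated for simply connected `Λ`
only and is false for the two-corridor interferometer; S2 propagates simple connectivity to the
inner configurations; (f) the refuted child `PortEqualisation` is not used (nothing is claimed
port-wise; only the quotient); (i) the cw-only reformulation is not needed (all stubs quantify over
every labelling, the ccw class being `0` by the proved Lemma 1).  Landed negatives checked:
`Theorems/NoFoldBound/Negative/Ring12Refutation` (`noFoldBound_false_without_simplyConnected`) —
S3/S4/S6 keep `hexDomainSimplyConnected`; no stub is an instance it refutes.
-/

namespace Summit.CriticalPhenomena.SAWScalingLimit.Cruxes.InteriorFlattening.OneMouthBallReduction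

open scoped BigOperators
open Literature.Probability.LatticeModels Literature.Probability.RandomPlanarGeometry.SAW
open Summit.CriticalPhenomena.SAWScalingLimit.Theorems.InteriorFlattening.OneMouth

noncomputable section

/-! ### The objects of the crux and the last-entrance configurations
 (`xc, Fobs, omega, bel, mono, zmass, pmass, IsStar, Deep, DepthFlat, ball, entr, Config, Conf, root, amp,
 Clean`) are IMPORTED from the objects-only Defs module
 `Summits/CriticalPhenomena/SAWScalingLimit/Theorems/SAWDevelopingMapInteriorFlatteningOneMouthDefs.lean`
 (landed p86194; namespace `…Theorems.InteriorFlattening.OneMouth`, opened above), shared with the stub files. -/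

/-! ### The six statements of the line, as named propositions -/

/-- **S1 statement — exact last-entrance factorisation.**  For `S ⊆ Λ`, a root `a` off `S` and a
mid-edge `{x, y}` inside `S`:  `F_{Λ,a}({x,y}) = Σ_{c ∈ Conf Λ S} amp(c) · F_{D_c, root c}({x,y})`. -/
def LastEntranceFactorisation : Prop :=
  ∀ (Λ S : Finset HexVertex) (a : Sym2 HexVertex) (x y : HexVertex),
    S ⊆ Λ → (∀ t ∈ a, t ∉ S) → x ∈ S → y ∈ S →
      Fobs Λ a s(x, y) = ∑ c ∈ Conf Λ S, amp Λ a S c * Fobs c.1 (root c) s(x, y)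

/-- **S2 statement — one-mouth sub-balls are simply connected.**  Removing from a lattice ball the
vertices of any self-avoiding walk that meets the outside of the ball leaves a simply connected
hexagonal domain (its complement = outside of the ball ∪ the walk, connected). -/
def OneMouthSimplyConnected : Prop :=
  ∀ (v : HexVertex) (r : ℝ) (S : Finset HexVertex),
    (∀ w : HexVertex, w ∈ S ↔ dist (hexCenter w) (hexCenter v) ≤ r) →
    ∀ (Λ : Finset HexVertex) (a z : Sym2 HexVertex) (γ : HexMidEdgeSAW Λ a z),
      (∃ t ∈ γ.verts, t ∉ S) → hexDomainSimplyConnected (S \ γ.verts.toFinset)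

/-- **S3 statement — far-field coherence (bounded amplification).**  One constant `A` such that for
every simply connected `Λ`, root `a ∈ ∂Λ`, `r ≥ 1` and vertex `v` with `B(v, 2r) ⊆ Λ` but NOT
`B(v, 4r) ⊆ Λ` (the WINDOW, reshape r2: the depth of `v` is tied to `r`; without it the amplification
grows like `(depth/r)^{25/48}`, exact enumeration `Â = 1.61 → 2.04` for `Λ = B(v,R)`, `R = 2 → 3.46`,
`r = 1` — stub_farFieldCoherence.blocked.md on the item), the configuration expansion of the monopole at
`v` through `S = B(v, r)` is `A`-coherent: `Σ_c ‖amp(c)‖ ‖M_c(v)‖ ≤ A ‖Σ_c amp(c) M_c(v)‖`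
(`= A ‖M_Λ(v)‖` by S1). -/
def FarFieldCoherence : Prop :=
  ∃ A : ℝ, 0 < A ∧ ∀ Λ : Finset HexVertex, hexDomainSimplyConnected Λ →
    ∀ a ∈ hexDomainBoundary Λ, ∀ v ∈ Λ, ∀ r : ℝ, 1 ≤ r → Deep Λ v (2 * r) → ¬ Deep Λ v (4 * r) →
    ∀ w₀ w₁ w₂ : HexVertex, IsStar v w₀ w₁ w₂ →
      (∑ c ∈ Conf Λ (ball Λ v r), ‖amp Λ a (ball Λ v r) c‖ * ‖mono c.1 (root c) v w₀ w₁ w₂‖) ≤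
        A * ‖∑ c ∈ Conf Λ (ball Λ v r), amp Λ a (ball Λ v r) c * mono c.1 (root c) v w₀ w₁ w₂‖

/-- **S4 statement — flattening of one-mouth balls (the clean core).**  For every aspect ratio
`η ∈ (0, 1]` and `e > 0` there is `r₀` such that for `r ≥ r₀`, every simply connected `D ⊆ B(v, r)`
containing the lattice ball `B(v, ηr)`, rooted at an entrance dart `u → u'` from outside `B(v, r)`,
has Beltrami quotient `≤ e` at `v` (every labelling). -/
def OneMouthBallFlattening : Prop :=
  ∀ η : ℝ, 0 < η → η ≤ 1 → ∀ e : ℝ, 0 < e → ∃ r₀ : ℝ, ∀ r : ℝ, r₀ ≤ r →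
    ∀ (D : Finset HexVertex) (u u' v : HexVertex), hexDomainSimplyConnected D →
      (∀ w ∈ D, dist (hexCenter w) (hexCenter v) ≤ r) → Deep D v (η * r) →
      hexGraph.Adj u u' → r < dist (hexCenter u) (hexCenter v) → u' ∈ D →
      ∀ w₀ w₁ w₂ : HexVertex, IsStar v w₀ w₁ w₂ →
        ‖bel D s(u, u') v w₀ w₁ w₂‖ ≤ e * ‖mono D s(u, u') v w₀ w₁ w₂‖

/-- **S5 statement — re-entry arm separation (the "arm gap"), two weightings.**
(i) given `ϑ > 0`, for some aspect ratio `η ∈ (0,1]` and all large `r`: the configurations of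
`S = B(v,r)` whose crosscuts penetrate `B(v, ηr)` carry at most the fraction `ϑ` of the coherent
weight `N = Σ_c ‖amp(c)‖‖M_c(v)‖`;  (ii) given `d₀ ≥ 0`, `ϑ > 0`, for all large `r`: the
configurations whose crosscuts penetrate the FIXED ball `B(v, d₀)`, weighted by far modulus times
inner MASS `Σ ‖amp(c)‖·pmass_c(v)`, are at most `ϑ N`.  Both in the WINDOW `B(v,2r) ⊆ Λ`,
`¬ B(v,4r) ⊆ Λ` (reshape r2, same one-scale regime as S3). -/
def ReentryArmSeparation : Prop :=
  (∀ ϑ : ℝ, 0 < ϑ → ∃ η : ℝ, 0 < η ∧ η ≤ 1 ∧ ∃ r₀ : ℝ, ∀ r : ℝ, r₀ ≤ r →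
    ∀ Λ : Finset HexVertex, hexDomainSimplyConnected Λ → ∀ a ∈ hexDomainBoundary Λ, ∀ v ∈ Λ,
      Deep Λ v (2 * r) → ¬ Deep Λ v (4 * r) → ∀ w₀ w₁ w₂ : HexVertex, IsStar v w₀ w₁ w₂ →
        (∑ c ∈ (Conf Λ (ball Λ v r)).filter (fun c => ¬ Clean (ball Λ v r) c.1 v (η * r)),
            ‖amp Λ a (ball Λ v r) c‖ * ‖mono c.1 (root c) v w₀ w₁ w₂‖) ≤
          ϑ * ∑ c ∈ Conf Λ (ball Λ v r),
            ‖amp Λ a (ball Λ v r) c‖ * ‖mono c.1 (root c) v w₀ w₁ w₂‖) ∧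
  (∀ d₀ : ℝ, 0 ≤ d₀ → ∀ ϑ : ℝ, 0 < ϑ → ∃ r₀ : ℝ, ∀ r : ℝ, r₀ ≤ r →
    ∀ Λ : Finset HexVertex, hexDomainSimplyConnected Λ → ∀ a ∈ hexDomainBoundary Λ, ∀ v ∈ Λ,
      Deep Λ v (2 * r) → ¬ Deep Λ v (4 * r) → ∀ w₀ w₁ w₂ : HexVertex, IsStar v w₀ w₁ w₂ →
        (∑ c ∈ (Conf Λ (ball Λ v r)).filter (fun c => ¬ Clean (ball Λ v r) c.1 v d₀),
            ‖amp Λ a (ball Λ v r) c‖ * pmass c.1 (root c) v w₀ w₁ w₂) ≤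
          ϑ * ∑ c ∈ Conf Λ (ball Λ v r),
            ‖amp Λ a (ball Λ v r) c‖ * ‖mono c.1 (root c) v w₀ w₁ w₂‖)

/-- **S6 statement — bounded distortion at some depth.**  `∃ d₁ K₁`: the Beltrami quotient is
`≤ K₁` at every `d₁`-deep vertex of every simply connected domain (no deep fold, with SOME
constant; weaker than `NoFoldBound` and than the crux, and necessary for the crux). -/
def DeepBoundedDistortion : Prop :=
  ∃ d₁ : ℝ, 0 ≤ d₁ ∧ ∃ K₁ : ℝ, 0 ≤ K₁ ∧ DepthFlat d₁ K₁

/-! ### The stubs (registered; signatures spelled out, definitionally the named statements) -/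

/-- **S1 — exact last-entrance factorisation** (finite combinatorics: cut at the last vertex outside
`S`; the outer piece is a `HexMidEdgeSAW Λ a {u,u'}` ending at `u`, the inner piece a
`HexMidEdgeSAW (S ∖ outer) {u,u'} {x,y}`; lengths add, windings add because `mid{u,u'}` lies on the
segment `c_u c_{u'}`; the gluing is a bijection; empty inner types give `F = 0`). Size L in Lean. -/
theorem stub_factorisation :
    ∀ (Λ S : Finset HexVertex) (a : Sym2 HexVertex) (x y : HexVertex),
      S ⊆ Λ → (∀ t ∈ a, t ∉ S) → x ∈ S → y ∈ S →
        Fobs Λ a s(x, y) = ∑ c ∈ Conf Λ S, amp Λ a S c * Fobs c.1 (root c) s(x, y) :=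
  -- CLOSED (wave 1, p89478): Theorems/SAWDevelopingMapInteriorFlatteningFactorisation.lean
  Summit.CriticalPhenomena.SAWScalingLimit.Theorems.InteriorFlattening.OneMouth.stub_factorisation

/-- **S2 — one-mouth sub-balls are simply connected** (lattice topology: the outside of a Euclidean
ball is connected in the honeycomb graph — every outside vertex has a strictly farther neighbour —
and the removed walk is a chain meeting it). Size M. -/
theorem stub_oneMouthSimplyConnected :
    ∀ (v : HexVertex) (r : ℝ) (S : Finset HexVertex),
      (∀ w : HexVertex, w ∈ S ↔ dist (hexCenter w) (hexCenter v) ≤ r) →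
      ∀ (Λ : Finset HexVertex) (a z : Sym2 HexVertex) (γ : HexMidEdgeSAW Λ a z),
        (∃ t ∈ γ.verts, t ∉ S) → hexDomainSimplyConnected (S \ γ.verts.toFinset) :=
  -- CLOSED (wave 1, p89024): Theorems/SAWDevelopingMapInteriorFlatteningOneMouthSimplyConnected.lean
  Summit.CriticalPhenomena.SAWScalingLimit.Theorems.InteriorFlattening.OneMouth.stub_oneMouthSimplyConnected

/-- **S3 — far-field coherence** (the card's lever; uses simple connectivity of `Λ` and the clean
collar `A(r, 2r)`: the far field cannot be a tuned interferometer, so the between-configuration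
spread of the conditional mean winding is bounded and the complex-weighted average does not
amplify). WINDOWED at reshape r2 (`¬ Deep Λ v (4 * r)`): one-scale statement. A SUFFICIENT condition is landed:
`farFieldCoherence_of_phaseConcentration` (PC η β ⇒ this, p91636); reshape r3 had PC as the registered atom, r4
reverts to THIS weakest needed statement because PC is numerically fragile (its optimal `A(β*)` grows with the aspect
while the true amplification stays ≈ 2–2.8: PC_numerics.md on the item). Size XL (open). -/
theorem stub_farFieldCoherence :
    ∃ A : ℝ, 0 < A ∧ ∀ Λ : Finset HexVertex, hexDomainSimplyConnected Λ →
      ∀ a ∈ hexDomainBoundary Λ, ∀ v ∈ Λ, ∀ r : ℝ, 1 ≤ r → Deep Λ v (2 * r) → ¬ Deep Λ v (4 * r) →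
      ∀ w₀ w₁ w₂ : HexVertex, IsStar v w₀ w₁ w₂ →
        (∑ c ∈ Conf Λ (ball Λ v r), ‖amp Λ a (ball Λ v r) c‖ * ‖mono c.1 (root c) v w₀ w₁ w₂‖) ≤
          A * ‖∑ c ∈ Conf Λ (ball Λ v r),
            amp Λ a (ball Λ v r) c * mono c.1 (root c) v w₀ w₁ w₂‖ := by
  sorry

/-- **S4 — flattening of one-mouth balls (HARDEST: the clean core of (M))**: orientation
independence of the arrival law at the centre of a bounded-aspect-ratio one-mouth ball with the
source on its outer sphere, for every fixed aspect ratio. Size XL (open; this is DCS's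
curl-vanishing with the far field removed). -/
theorem stub_oneMouthBallFlattening :
    ∀ η : ℝ, 0 < η → η ≤ 1 → ∀ e : ℝ, 0 < e → ∃ r₀ : ℝ, ∀ r : ℝ, r₀ ≤ r →
      ∀ (D : Finset HexVertex) (u u' v : HexVertex), hexDomainSimplyConnected D →
        (∀ w ∈ D, dist (hexCenter w) (hexCenter v) ≤ r) → Deep D v (η * r) →
        hexGraph.Adj u u' → r < dist (hexCenter u) (hexCenter v) → u' ∈ D →
        ∀ w₀ w₁ w₂ : HexVertex, IsStar v w₀ w₁ w₂ →
          ‖bel D s(u, u') v w₀ w₁ w₂‖ ≤ e * ‖mono D s(u, u') v w₀ w₁ w₂‖ := by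
  sorry

/-- **S5 — re-entry arm separation** (3 crossings of an annulus by the arriving walk against 1:
bulk watermelon exponents `x₃ − x₁ = 77/48 − 5/48 = 3/2` for the mass fraction, beating the
monopole loss `|M|/mass ≍ r^{-25/48}` that converts mass weights into coherent weights).
WINDOWED at reshape r2 (`¬ Deep Λ v (4 * r)`, same regime as S3). Follows from the worker's
E1 `CoherentReentryGap ρ` + E2 `CleanMonopoleLowerBound κ` (+ E3 `MonopoleDecoherence κ` for (i)),
`0 ≤ κ < ρ` — LANDED as `reentryArmSeparation_of_armEstimates` (p91887; conjunct (ii) from E1+E2 alone, p91480); r4 keeps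
THIS weakest needed statement as the registered stub (MC: κ = 0.51 ± 0.02 ≈ 25/48 on clean balls, S4_mc_numerics.md).
Size XL (open: no multi-arm technology for planar SAW at `n = 0`). -/
theorem stub_reentryArmSeparation :
    (∀ ϑ : ℝ, 0 < ϑ → ∃ η : ℝ, 0 < η ∧ η ≤ 1 ∧ ∃ r₀ : ℝ, ∀ r : ℝ, r₀ ≤ r →
      ∀ Λ : Finset HexVertex, hexDomainSimplyConnected Λ → ∀ a ∈ hexDomainBoundary Λ, ∀ v ∈ Λ,
        Deep Λ v (2 * r) → ¬ Deep Λ v (4 * r) → ∀ w₀ w₁ w₂ : HexVertex, IsStar v w₀ w₁ w₂ →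
          (∑ c ∈ (Conf Λ (ball Λ v r)).filter (fun c => ¬ Clean (ball Λ v r) c.1 v (η * r)),
              ‖amp Λ a (ball Λ v r) c‖ * ‖mono c.1 (root c) v w₀ w₁ w₂‖) ≤
            ϑ * ∑ c ∈ Conf Λ (ball Λ v r),
              ‖amp Λ a (ball Λ v r) c‖ * ‖mono c.1 (root c) v w₀ w₁ w₂‖) ∧
    (∀ d₀ : ℝ, 0 ≤ d₀ → ∀ ϑ : ℝ, 0 < ϑ → ∃ r₀ : ℝ, ∀ r : ℝ, r₀ ≤ r →
      ∀ Λ : Finset HexVertex, hexDomainSimplyConnected Λ → ∀ a ∈ hexDomainBoundary Λ, ∀ v ∈ Λ,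
        Deep Λ v (2 * r) → ¬ Deep Λ v (4 * r) → ∀ w₀ w₁ w₂ : HexVertex, IsStar v w₀ w₁ w₂ →
          (∑ c ∈ (Conf Λ (ball Λ v r)).filter (fun c => ¬ Clean (ball Λ v r) c.1 v d₀),
              ‖amp Λ a (ball Λ v r) c‖ * pmass c.1 (root c) v w₀ w₁ w₂) ≤
            ϑ * ∑ c ∈ Conf Λ (ball Λ v r),
              ‖amp Λ a (ball Λ v r) c‖ * ‖mono c.1 (root c) v w₀ w₁ w₂‖) := by
  sorry

/-- **S6 — bounded distortion at some depth** (the developing map is quasiconformal away from the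
boundary with SOME constant: `∃ d₁ K₁, DepthFlat d₁ K₁`; implied by `NoFoldBound` (d₁ = 0, K₁ = k)
and by the crux itself (K₁ = 1); attackable by compactness of root-normalised local limits +
Lemma 1). Size L. -/
theorem stub_deepBoundedDistortion :
    ∃ d₁ : ℝ, 0 ≤ d₁ ∧ ∃ K₁ : ℝ, 0 ≤ K₁ ∧ DepthFlat d₁ K₁ := by
  sorry

/-! ### Consistency: each named statement IS its registered stub (definitionally) -/

theorem lastEntranceFactorisation_holds : LastEntranceFactorisation := stub_factorisation
theorem oneMouthSimplyConnected_holds : OneMouthSimplyConnected := stub_oneMouthSimplyConnected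
theorem farFieldCoherence_holds : FarFieldCoherence := stub_farFieldCoherence
theorem oneMouthBallFlattening_holds : OneMouthBallFlattening := stub_oneMouthBallFlattening
theorem reentryArmSeparation_holds : ReentryArmSeparation := stub_reentryArmSeparation
theorem deepBoundedDistortion_holds : DeepBoundedDistortion := stub_deepBoundedDistortion

/-! ### Name-keyed aliases of the six statements (the hypotheses of the composition) -/
namespace Registered

/-- Alias of `LastEntranceFactorisation` keyed by the registered stub name. -/
abbrev stub_factorisation : Prop := LastEntranceFactorisation
/-- Alias of `OneMouthSimplyConnected` keyed by the registered stub name. -/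
abbrev stub_oneMouthSimplyConnected : Prop := OneMouthSimplyConnected
/-- Alias of `FarFieldCoherence` keyed by the registered stub name. -/
abbrev stub_farFieldCoherence : Prop := FarFieldCoherence
/-- Alias of `OneMouthBallFlattening` keyed by the registered stub name. -/
abbrev stub_oneMouthBallFlattening : Prop := OneMouthBallFlattening
/-- Alias of `ReentryArmSeparation` keyed by the registered stub name. -/
abbrev stub_reentryArmSeparation : Prop := ReentryArmSeparation
/-- Alias of `DeepBoundedDistortion` keyed by the registered stub name. -/
abbrev stub_deepBoundedDistortion : Prop := DeepBoundedDistortion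

end Registered

/-! ### Proved glue -/

/-- `‖ω‖ = 1`. -/
theorem norm_omega : ‖omega‖ = 1 := by
  have h : (2 * (Real.pi : ℂ) * Complex.I / 3) = ((2 * Real.pi / 3 : ℝ) : ℂ) * Complex.I := by
    push_cast; ring
  rw [omega, h, Complex.norm_exp_ofReal_mul_I]

/-- The crude bound `‖B_D(v)‖ ≤ pmass_D(v)` (triangle inequality, `‖ω‖ = 1`). -/
theorem norm_bel_le_pmass (Λ : Finset HexVertex) (a : Sym2 HexVertex) (v w₀ w₁ w₂ : HexVertex) :
    ‖bel Λ a v w₀ w₁ w₂‖ ≤ pmass Λ a v w₀ w₁ w₂ := by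
  unfold bel pmass
  have h0 := norm_Fobs_le_zmass Λ a s(v, w₀)
  have h1 := norm_Fobs_le_zmass Λ a s(v, w₁)
  have h2 := norm_Fobs_le_zmass Λ a s(v, w₂)
  calc ‖Fobs Λ a s(v, w₀) + omega * Fobs Λ a s(v, w₁) + omega ^ 2 * Fobs Λ a s(v, w₂)‖
      ≤ ‖Fobs Λ a s(v, w₀)‖ + ‖omega * Fobs Λ a s(v, w₁)‖ + ‖omega ^ 2 * Fobs Λ a s(v, w₂)‖ :=
        norm_add₃_le
    _ = ‖Fobs Λ a s(v, w₀)‖ + ‖Fobs Λ a s(v, w₁)‖ + ‖Fobs Λ a s(v, w₂)‖ := by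
        rw [norm_mul, norm_mul, norm_pow, norm_omega]; ring
    _ ≤ _ := by linarith

/-- If the root `{u, u'}` has no endpoint in `D`, the observable of `D` vanishes identically. -/
theorem Fobs_eq_zero_of_not_mem {D : Finset HexVertex} {u u' : HexVertex} (hu : u ∉ D)
    (hu' : u' ∉ D) (z : Sym2 HexVertex) : Fobs D s(u, u') z = 0 := by
  refine hexParafermionicObservable_eq_zero_of_not_mem ?_ _ _ _
  rintro ⟨-, t, ht, htD⟩
  rcases Sym2.mem_iff.1 ht with rfl | rfl
  · exact hu htD
  · exact hu' htD

/-- From `l.getLast? = some a` to `a ∈ l`. -/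
theorem mem_of_getLast?_eq_some' {α : Type*} {l : List α} {a : α} (h : l.getLast? = some a) :
    a ∈ l := by
  have hne : l ≠ [] := by rintro rfl; simp at h
  rw [List.getLast?_eq_some_getLast hne] at h
  obtain rfl := Option.some.inj h
  exact List.getLast_mem hne

/-- Adjacent honeycomb vertices have centres at squared distance `1/3`. -/
theorem normSq_hexCenter_sub_of_adj {v t : HexVertex} (h : hexGraph.Adj v t) :
    Complex.normSq (hexCenter t - hexCenter v) = 1 / 3 := by
  obtain ⟨x, i⟩ := t
  obtain ⟨y, j⟩ := v
  rw [hexCenter_sub_hexCenter, normSq_add_mul_triZeta]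
  fin_cases i <;> fin_cases j
  · exact absurd h
      (Literature.Barriers.CriticalPhenomena.HexKernel.not_hexGraph_adj_of_snd_eq_holds _ _ rfl)
  · rcases (Literature.Barriers.CriticalPhenomena.HexKernel.hexGraph_adj_iff_of_snd_eq_zero_holds
        x y).1 h.symm with rfl | rfl | rfl
    · simp; norm_num
    · simp [Pi.sub_apply]; norm_num
    · simp [Pi.sub_apply]; norm_num
  · rcases (Literature.Barriers.CriticalPhenomena.HexKernel.hexGraph_adj_iff_of_snd_eq_zero_holds
        y x).1 h with rfl | rfl | rfl
    · simp; norm_num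
    · simp [Pi.sub_apply]; norm_num
    · simp [Pi.sub_apply]; norm_num
  · exact absurd h
      (Literature.Barriers.CriticalPhenomena.HexKernel.not_hexGraph_adj_of_snd_eq_holds _ _ rfl)

/-- Adjacent honeycomb vertices are at distance `≤ 1` (the distance is `1/√3`). -/
theorem dist_le_one_of_adj {v t : HexVertex} (h : hexGraph.Adj v t) :
    dist (hexCenter t) (hexCenter v) ≤ 1 := by
  rw [dist_eq_norm, ← sq_le_one_iff₀ (norm_nonneg _), Complex.sq_norm,
    normSq_hexCenter_sub_of_adj h]
  norm_num

/-- `DepthFlat` is monotone in the constant. -/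
theorem depthFlat_mono {d k k' : ℝ} (hk : k ≤ k') (h : DepthFlat d k) : DepthFlat d k' :=
  fun Λ hΛ a ha v hv hd w₀ w₁ w₂ hs =>
    (h Λ hΛ a ha v hv hd w₀ w₁ w₂ hs).trans (mul_le_mul_of_nonneg_right hk (norm_nonneg _))

/-- `Deep` is antitone in the radius. -/
theorem deep_anti {Λ : Finset HexVertex} {v : HexVertex} {R R' : ℝ} (h : Deep Λ v R) (hle : R' ≤ R) :
    Deep Λ v R' := fun w hw => h w (hw.trans hle)

/-- A finite domain is not deep at every scale: some lattice vertex lies outside `Λ`. -/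
theorem exists_not_deep (Λ : Finset HexVertex) (v : HexVertex) : ∃ R : ℝ, ¬ Deep Λ v R := by
  haveI : Infinite (Site 2) := Pi.infinite_of_right
  obtain ⟨w, hw⟩ := Infinite.exists_notMem_finset Λ
  exact ⟨dist (hexCenter w) (hexCenter v), fun h => hw (h w le_rfl)⟩

/-- **Dyadic window** (reshape r2, from the S3 worker's analysis). If `v` is `2r₀`-deep (`r₀ > 0`)
there is an adaptive radius `r ≥ r₀` at which `v` is `2r`-deep but NOT `4r`-deep (`r = 2^k r₀` for the
last good `k`; `k` is bounded because `Λ` is finite). This lets the one-scale estimate use the WINDOWED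
far-field coherence S3 and arm gap S5, whose depth must be tied to the ball radius. -/
theorem exists_window (Λ : Finset HexVertex) (v : HexVertex) {r₀ : ℝ} (h₀ : 0 < r₀)
    (h : Deep Λ v (2 * r₀)) : ∃ r : ℝ, r₀ ≤ r ∧ Deep Λ v (2 * r) ∧ ¬ Deep Λ v (4 * r) := by
  by_contra hcon
  push Not at hcon
  have hall : ∀ k : ℕ, Deep Λ v (2 * (2 ^ k * r₀)) := by
    intro k
    induction k with
    | zero => simpa using h
    | succ k ih =>
      have hk : r₀ ≤ 2 ^ k * r₀ := le_mul_of_one_le_left h₀.le (one_le_pow₀ (by norm_num))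
      have := hcon (2 ^ k * r₀) hk ih
      have e : (4 : ℝ) * (2 ^ k * r₀) = 2 * (2 ^ (k + 1) * r₀) := by ring
      rwa [e] at this
  obtain ⟨R, hR⟩ := exists_not_deep Λ v
  obtain ⟨k, hk⟩ := pow_unbounded_of_one_lt (R / (2 * r₀)) (by norm_num : (1 : ℝ) < 2)
  have hle : R ≤ 2 * (2 ^ k * r₀) := by
    have h2 : 0 < 2 * r₀ := by positivity
    have := (div_lt_iff₀ h2).1 hk
    nlinarith
  exact hR (deep_anti (hall k) hle)

/-! ### The one-scale estimate: the six statements give `∀ ε > 0, ∃ R, DepthFlat R ε` -/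

/-- **One-scale estimate.**  From S1–S6: for every `ε > 0` there is `R` with `DepthFlat R ε`. -/
theorem depthFlat_of (h1 : LastEntranceFactorisation) (h2 : OneMouthSimplyConnected)
    (h3 : FarFieldCoherence) (h4 : OneMouthBallFlattening) (h5 : ReentryArmSeparation)
    (h6 : DeepBoundedDistortion) : ∀ ε : ℝ, 0 < ε → ∃ R : ℝ, DepthFlat R ε := by
  intro ε hε
  obtain ⟨A, hA, hcoh⟩ := h3
  obtain ⟨d₁, hd₁, K₁, hK₁, hqc⟩ := h6
  -- constants
  set e : ℝ := ε / (3 * A) with he_def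
  have he : 0 < e := by positivity
  set ϑB : ℝ := ε / (3 * A * (K₁ + 1)) with hϑB_def
  have hϑB : 0 < ϑB := by positivity
  obtain ⟨η, hη, hη1, r₁, h5i⟩ := h5.1 ϑB hϑB
  obtain ⟨r₂, h5ii⟩ := h5.2 d₁ hd₁ e he
  obtain ⟨r₃, h4'⟩ := h4 η hη hη1 e he
  set R₀ : ℝ := max (max (max r₁ r₂) (max r₃ d₁)) 1 with hR₀_def
  have hR₁ : r₁ ≤ R₀ := le_trans (le_trans (le_max_left _ _) (le_max_left _ _)) (le_max_left _ _)
  have hR₂ : r₂ ≤ R₀ := le_trans (le_trans (le_max_right _ _) (le_max_left _ _)) (le_max_left _ _)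
  have hR₃ : r₃ ≤ R₀ := le_trans (le_trans (le_max_left _ _) (le_max_right _ _)) (le_max_left _ _)
  have hRd : d₁ ≤ R₀ := le_trans (le_trans (le_max_right _ _) (le_max_right _ _)) (le_max_left _ _)
  have hR1 : 1 ≤ R₀ := le_max_right _ _
  refine ⟨2 * R₀, ?_⟩
  intro Λ hΛ a ha v hv hdeep₀ w₀ w₁ w₂ hstar
  -- the ADAPTIVE radius: a dyadic window `r ≥ R₀` with `B(v,2r) ⊆ Λ` but NOT `B(v,4r) ⊆ Λ`
  -- (reshape r2: far-field coherence and the arm gap are one-scale statements — the depth of `v`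
  -- must be tied to `r`, see `Lines/one-mouth-ball-reduction.md` §S3 / stub_farFieldCoherence.blocked.md)
  obtain ⟨r, hR₀r, hdeep, hwin⟩ := exists_window Λ v (lt_of_lt_of_le zero_lt_one hR1) hdeep₀
  have hr₁ : r₁ ≤ r := hR₁.trans hR₀r
  have hr₂ : r₂ ≤ r := hR₂.trans hR₀r
  have hr₃ : r₃ ≤ r := hR₃.trans hR₀r
  have hrd : d₁ ≤ r := hRd.trans hR₀r
  have hr1 : 1 ≤ r := hR1.trans hR₀r
  have hr0 : 0 ≤ r := zero_le_one.trans hr1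
  -- the specialised stub facts (before abbreviating the ball)
  have H5i := h5i r hr₁ Λ hΛ a ha v hv hdeep hwin w₀ w₁ w₂ hstar
  have H5ii := h5ii r hr₂ Λ hΛ a ha v hv hdeep hwin w₀ w₁ w₂ hstar
  have Hcoh := hcoh Λ hΛ a ha v hv r hr1 hdeep hwin w₀ w₁ w₂ hstar
  have H4 := h4' r hr₃
  set S : Finset HexVertex := ball Λ v r with hS_def
  -- basic facts about the ball `S`
  have hSΛ : S ⊆ Λ := Finset.filter_subset _ _
  have hSmem : ∀ w : HexVertex, w ∈ S ↔ dist (hexCenter w) (hexCenter v) ≤ r := by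
    intro w
    simp only [hS_def, ball, Finset.mem_filter]
    constructor
    · exact And.right
    · intro hw
      exact ⟨hdeep w (by linarith), hw⟩
  have hvS : v ∈ S := (hSmem v).2 (by rw [dist_self]; exact hr0)
  obtain ⟨hw₀, hw₁, hw₂, -, -, -⟩ := id hstar
  have hwS : ∀ w : HexVertex, hexGraph.Adj v w → w ∈ S := fun w hw =>
    (hSmem w).2 ((dist_le_one_of_adj hw).trans hr1)
  have haS : ∀ t ∈ a, t ∉ S := by
    obtain ⟨hae, u₀, v₁, rfl, hv₁, hu₀⟩ := ha
    have hadj : hexGraph.Adj u₀ v₁ := by simpa using hae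
    have hu₀far : ¬ dist (hexCenter u₀) (hexCenter v) ≤ 2 * r := fun h => hu₀ (hdeep u₀ h)
    intro t ht htS
    have htr : dist (hexCenter t) (hexCenter v) ≤ r := (hSmem t).1 htS
    rcases Sym2.mem_iff.1 ht with rfl | rfl
    · exact hu₀far (by linarith)
    · have h1 : dist (hexCenter u₀) (hexCenter t) ≤ 1 := by
        rw [dist_comm]; exact dist_le_one_of_adj hadj
      have := dist_triangle (hexCenter u₀) (hexCenter t) (hexCenter v)
      exact hu₀far (by linarith)
  -- S1: the configuration expansion of the three port values, hence of `bel` and `mono`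
  have hF : ∀ w : HexVertex, hexGraph.Adj v w →
      Fobs Λ a s(v, w) = ∑ c ∈ Conf Λ S, amp Λ a S c * Fobs c.1 (root c) s(v, w) :=
    fun w hw => h1 Λ S a v w hSΛ haS hvS (hwS w hw)
  have hbel : bel Λ a v w₀ w₁ w₂ = ∑ c ∈ Conf Λ S, amp Λ a S c * bel c.1 (root c) v w₀ w₁ w₂ := by
    simp only [bel, hF w₀ hw₀, hF w₁ hw₁, hF w₂ hw₂, Finset.mul_sum, ← Finset.sum_add_distrib]
    exact Finset.sum_congr rfl fun c _ => by ring
  have hmono : mono Λ a v w₀ w₁ w₂ =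
      ∑ c ∈ Conf Λ S, amp Λ a S c * mono c.1 (root c) v w₀ w₁ w₂ := by
    simp only [mono, hF w₀ hw₀, hF w₁ hw₁, hF w₂ hw₂, ← Finset.sum_add_distrib]
    exact Finset.sum_congr rfl fun c _ => by ring
  -- the coherent weight `N`
  obtain ⟨N, hN⟩ : ∃ N : ℝ, N = ∑ c ∈ Conf Λ S, ‖amp Λ a S c‖ * ‖mono c.1 (root c) v w₀ w₁ w₂‖ :=
    ⟨_, rfl⟩
  have hNnonneg : 0 ≤ N :=
    hN ▸ Finset.sum_nonneg fun c _ => mul_nonneg (norm_nonneg _) (norm_nonneg _)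
  rw [← hN] at H5i H5ii Hcoh
  -- per-configuration bound (three tiers)
  have hpt : ∀ c ∈ Conf Λ S,
      ‖amp Λ a S c‖ * ‖bel c.1 (root c) v w₀ w₁ w₂‖ ≤
        e * (‖amp Λ a S c‖ * ‖mono c.1 (root c) v w₀ w₁ w₂‖) +
        K₁ * (if ¬ Clean S c.1 v (η * r) then ‖amp Λ a S c‖ * ‖mono c.1 (root c) v w₀ w₁ w₂‖
          else 0) +
        (if ¬ Clean S c.1 v d₁ then ‖amp Λ a S c‖ * pmass c.1 (root c) v w₀ w₁ w₂ else 0) := by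
    rintro ⟨D, u, u'⟩ hc
    simp only [Conf, entr, Finset.mem_product, Finset.mem_powerset, Finset.mem_filter] at hc
    obtain ⟨hDS, ⟨huΛ, hu'S⟩, huS, hadj⟩ := hc
    simp only [root]
    -- nonnegativity of the three terms
    have n₁ : 0 ≤ ‖amp Λ a S (D, u, u')‖ * ‖mono D s(u, u') v w₀ w₁ w₂‖ :=
      mul_nonneg (norm_nonneg _) (norm_nonneg _)
    have hpm : 0 ≤ pmass D s(u, u') v w₀ w₁ w₂ := by
      unfold pmass zmass
      have := xc_nonneg
      positivity
    have n₂ : 0 ≤ ‖amp Λ a S (D, u, u')‖ * pmass D s(u, u') v w₀ w₁ w₂ :=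
      mul_nonneg (norm_nonneg _) hpm
    have T1 : 0 ≤ e * (‖amp Λ a S (D, u, u')‖ * ‖mono D s(u, u') v w₀ w₁ w₂‖) :=
      mul_nonneg he.le n₁
    have T2 : 0 ≤ K₁ * (if ¬ Clean S D v (η * r) then
        ‖amp Λ a S (D, u, u')‖ * ‖mono D s(u, u') v w₀ w₁ w₂‖ else 0) := by
      refine mul_nonneg hK₁ ?_
      split_ifs <;> first | exact le_rfl | exact n₁
    have T3 : 0 ≤ (if ¬ Clean S D v d₁ then
        ‖amp Λ a S (D, u, u')‖ * pmass D s(u, u') v w₀ w₁ w₂ else 0) := by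
      split_ifs <;> first | exact le_rfl | exact n₂
    -- trivial when the far amplitude vanishes
    by_cases hamp : amp Λ a S (D, u, u') = 0
    · have h0 : ‖amp Λ a S (D, u, u')‖ * ‖bel D s(u, u') v w₀ w₁ w₂‖ = 0 := by
        rw [hamp, norm_zero, zero_mul]
      rw [h0]
      exact add_nonneg (add_nonneg T1 T2) T3
    -- otherwise some outer piece realises the configuration: `D = S ∖ γ`, `u` its last vertex
    obtain ⟨γ, -, hγ⟩ := Finset.exists_ne_zero_of_sum_ne_zero hamp
    have hcond : γ.verts.getLast? = some u ∧ S \ γ.verts.toFinset = D := by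
      by_contra hno
      exact hγ (if_neg hno)
    obtain ⟨hlast, hD⟩ := hcond
    have huD : u ∉ D := fun h => huS (hDS h)
    have hsc : hexDomainSimplyConnected D := by
      rw [← hD]
      exact h2 v r S hSmem Λ a _ γ ⟨u, mem_of_getLast?_eq_some' hlast, huS⟩
    have hDr : ∀ w ∈ D, dist (hexCenter w) (hexCenter v) ≤ r := fun w hw => (hSmem w).1 (hDS hw)
    have hur : r < dist (hexCenter u) (hexCenter v) := by
      by_contra hle
      exact huS ((hSmem u).2 (not_lt.1 hle))
    -- trivial when the inner endpoint of the root was eaten by the outer piece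
    by_cases hu'D : u' ∈ D
    swap
    · have hb : bel D s(u, u') v w₀ w₁ w₂ = 0 := by
        simp only [bel, Fobs_eq_zero_of_not_mem huD hu'D, mul_zero, add_zero]
      rw [hb, norm_zero, mul_zero]
      exact add_nonneg (add_nonneg T1 T2) T3
    -- the three tiers
    by_cases hA : Clean S D v (η * r)
    · -- tier A (no crosscut within `ηr`): one-mouth ball flattening (S4)
      have hdeepD : Deep D v (η * r) := by
        intro w hw
        have hwr : dist (hexCenter w) (hexCenter v) ≤ r := by
          have : η * r ≤ 1 * r := mul_le_mul_of_nonneg_right hη1 hr0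
          linarith
        exact hA w ((hSmem w).2 hwr) hw
      have hq := H4 D u u' v hsc hDr hdeepD hadj hur hu'D w₀ w₁ w₂ hstar
      have hle : ‖amp Λ a S (D, u, u')‖ * ‖bel D s(u, u') v w₀ w₁ w₂‖ ≤
          e * (‖amp Λ a S (D, u, u')‖ * ‖mono D s(u, u') v w₀ w₁ w₂‖) :=
        calc ‖amp Λ a S (D, u, u')‖ * ‖bel D s(u, u') v w₀ w₁ w₂‖
            ≤ ‖amp Λ a S (D, u, u')‖ * (e * ‖mono D s(u, u') v w₀ w₁ w₂‖) :=
              mul_le_mul_of_nonneg_left hq (norm_nonneg _)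
          _ = e * (‖amp Λ a S (D, u, u')‖ * ‖mono D s(u, u') v w₀ w₁ w₂‖) := by ring
      linarith [T2, T3]
    · by_cases hB : Clean S D v d₁
      · -- tier B (crosscut within `ηr` but not within `d₁`): bounded distortion (S6)
        have hdeepD : Deep D v d₁ := fun w hw => hB w ((hSmem w).2 (hw.trans hrd)) hw
        have hvD : v ∈ D := hdeepD v (by rw [dist_self]; exact hd₁)
        have hbd : s(u, u') ∈ hexDomainBoundary D :=
          ⟨(SimpleGraph.mem_edgeSet _).2 hadj, u, u', rfl, hu'D, huD⟩
        have hq := hqc D hsc _ hbd v hvD hdeepD w₀ w₁ w₂ hstar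
        have hle : ‖amp Λ a S (D, u, u')‖ * ‖bel D s(u, u') v w₀ w₁ w₂‖ ≤
            K₁ * (‖amp Λ a S (D, u, u')‖ * ‖mono D s(u, u') v w₀ w₁ w₂‖) :=
          calc ‖amp Λ a S (D, u, u')‖ * ‖bel D s(u, u') v w₀ w₁ w₂‖
              ≤ ‖amp Λ a S (D, u, u')‖ * (K₁ * ‖mono D s(u, u') v w₀ w₁ w₂‖) :=
                mul_le_mul_of_nonneg_left hq (norm_nonneg _)
            _ = K₁ * (‖amp Λ a S (D, u, u')‖ * ‖mono D s(u, u') v w₀ w₁ w₂‖) := by ring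
        rw [if_pos hA]
        linarith [T1, T3]
      · -- tier C (crosscut within `d₁`): the crude mass bound
        have hle : ‖amp Λ a S (D, u, u')‖ * ‖bel D s(u, u') v w₀ w₁ w₂‖ ≤
            ‖amp Λ a S (D, u, u')‖ * pmass D s(u, u') v w₀ w₁ w₂ :=
          mul_le_mul_of_nonneg_left (norm_bel_le_pmass D s(u, u') v w₀ w₁ w₂) (norm_nonneg _)
        rw [if_pos hB]
        linarith [T1, T2]
  -- summing the per-configuration bounds
  have eq1 : (∑ c ∈ Conf Λ S,
      (e * (‖amp Λ a S c‖ * ‖mono c.1 (root c) v w₀ w₁ w₂‖) +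
        K₁ * (if ¬ Clean S c.1 v (η * r) then ‖amp Λ a S c‖ * ‖mono c.1 (root c) v w₀ w₁ w₂‖
          else 0) +
        (if ¬ Clean S c.1 v d₁ then ‖amp Λ a S c‖ * pmass c.1 (root c) v w₀ w₁ w₂ else 0))) =
      e * N +
        K₁ * (∑ c ∈ (Conf Λ S).filter (fun c => ¬ Clean S c.1 v (η * r)),
          ‖amp Λ a S c‖ * ‖mono c.1 (root c) v w₀ w₁ w₂‖) +
        ∑ c ∈ (Conf Λ S).filter (fun c => ¬ Clean S c.1 v d₁),
          ‖amp Λ a S c‖ * pmass c.1 (root c) v w₀ w₁ w₂ := by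
    rw [Finset.sum_add_distrib, Finset.sum_add_distrib, ← Finset.mul_sum, ← Finset.mul_sum,
      Finset.sum_filter, Finset.sum_filter, hN]
  have hKe : K₁ * ϑB ≤ e := by
    have h1 : K₁ / (K₁ + 1) ≤ 1 := by
      rw [div_le_one (by linarith)]
      linarith
    calc K₁ * ϑB = (K₁ / (K₁ + 1)) * e := by
          rw [hϑB_def, he_def]
          field_simp
      _ ≤ 1 * e := mul_le_mul_of_nonneg_right h1 he.le
      _ = e := one_mul e
  have hcohN : N ≤ A * ‖mono Λ a v w₀ w₁ w₂‖ := by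
    rw [hmono]
    exact Hcoh
  -- the one-scale estimate
  calc ‖bel Λ a v w₀ w₁ w₂‖
      = ‖∑ c ∈ Conf Λ S, amp Λ a S c * bel c.1 (root c) v w₀ w₁ w₂‖ := by rw [hbel]
    _ ≤ ∑ c ∈ Conf Λ S, ‖amp Λ a S c * bel c.1 (root c) v w₀ w₁ w₂‖ := norm_sum_le _ _
    _ = ∑ c ∈ Conf Λ S, ‖amp Λ a S c‖ * ‖bel c.1 (root c) v w₀ w₁ w₂‖ :=
        Finset.sum_congr rfl fun c _ => norm_mul _ _
    _ ≤ ∑ c ∈ Conf Λ S,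
          (e * (‖amp Λ a S c‖ * ‖mono c.1 (root c) v w₀ w₁ w₂‖) +
            K₁ * (if ¬ Clean S c.1 v (η * r) then
              ‖amp Λ a S c‖ * ‖mono c.1 (root c) v w₀ w₁ w₂‖ else 0) +
            (if ¬ Clean S c.1 v d₁ then ‖amp Λ a S c‖ * pmass c.1 (root c) v w₀ w₁ w₂ else 0)) :=
        Finset.sum_le_sum hpt
    _ = e * N +
          K₁ * (∑ c ∈ (Conf Λ S).filter (fun c => ¬ Clean S c.1 v (η * r)),
            ‖amp Λ a S c‖ * ‖mono c.1 (root c) v w₀ w₁ w₂‖) +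
          ∑ c ∈ (Conf Λ S).filter (fun c => ¬ Clean S c.1 v d₁),
            ‖amp Λ a S c‖ * pmass c.1 (root c) v w₀ w₁ w₂ := eq1
    _ ≤ e * N + K₁ * (ϑB * N) + e * N := by gcongr
    _ = (e + K₁ * ϑB + e) * N := by ring
    _ ≤ (e + e + e) * N := by gcongr
    _ = (ε / A) * N := by rw [he_def]; ring
    _ ≤ (ε / A) * (A * ‖mono Λ a v w₀ w₁ w₂‖) := by gcongr
    _ = ε * ‖mono Λ a v w₀ w₁ w₂‖ := by field_simp

/-! ### Composition: the four open stubs imply the crux BY NAME (S1, S2 closed) -/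

/-- **The line concludes the crux.** -/
theorem InteriorFlattening_of (h3 : Registered.stub_farFieldCoherence)
    (h4 : Registered.stub_oneMouthBallFlattening) (h5 : Registered.stub_reentryArmSeparation)
    (h6 : Registered.stub_deepBoundedDistortion) :
    Summit.CriticalPhenomena.SAWScalingLimit.Theses.SAWDevelopingMap.InteriorFlattening := by
  -- S1 and S2 are CLOSED (p89478, p89024): discharged inside, no longer hypotheses (reshape r2)
  have key : ∀ ε : ℝ, 0 < ε → ∃ R : ℝ, DepthFlat R ε :=
    depthFlat_of lastEntranceFactorisation_holds oneMouthSimplyConnected_holds h3 h4 h5 h6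
  intro ε hε
  obtain ⟨R, hR⟩ := key ε hε
  refine ⟨R, ?_⟩
  intro Λ hΛ a ha v hv hb w₀ w₁ w₂ h₀ h₁ h₂ n₁ n₂ n₃
  exact hR Λ hΛ a ha v hv hb w₀ w₁ w₂ ⟨h₀, h₁, h₂, n₁, n₂, n₃⟩

/-- Wiring check: the registered stubs feed `InteriorFlattening_of` as stated. -/
example : Summit.CriticalPhenomena.SAWScalingLimit.Theses.SAWDevelopingMap.InteriorFlattening :=
  InteriorFlattening_of stub_farFieldCoherence stub_oneMouthBallFlattening stub_reentryArmSeparation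
    stub_deepBoundedDistortion

end

end Summit.CriticalPhenomena.SAWScalingLimit.Cruxes.InteriorFlattening.OneMouthBallReduction
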